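import Mathlib
import HarnessLib
import Summits.CriticalPhenomena.Ising3DConformalLimit.Theses.HyperoctahedralRP
import Summits.CriticalPhenomena.Ising3DConformalLimit.Theorems.HyperoctahedralRPTwoPointKernelOfLimit

/-!
# `TwoPointLimitIsotropic` reduced to the crux `HRP2Rigidity`
(route HyperoctahedralRP, milestone item stmt-CriticalPhenomena-1984)

The milestone `TwoPointLimitIsotropic` — two-point isotropy `S 2 (0, R x) = S 2 (0, x)` (`x ≠ 0`,
all linear isometries `R`) of every non-degenerate, translation-invariant, scale-covariant pointwise
scaling limit `S` of the critical `ℤ³` Ising correlators, an open problem as such (Duminil-Copin,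
ICM 2022, §8.1) — is by the route's design the composition of the crux `HRP2Rigidity` (item
stmt-1979: continuous positive kernels on `ℝ³∖{0}`, homogeneous of degree `-2Δ` with
`1/2 ≤ Δ ≤ 1`, invariant and reflection positive with respect to the nine lattice mirrors, are
`O(3)`-invariant) with the glue `TwoPointKernelOfLimit` (item stmt-1983: the kernel
`x ↦ S 2 (0, x)` of such a limit meets those hypotheses). The glue is PROVED in the tree
(`twoPointKernelOfLimit_proof`, with the nine-mirror lattice reflection positivity
`criticalCorrNineMirrorRP_proof`), so the milestone now hinges on the crux alone:
`twoPointLimitIsotropic_of_HRP2Rigidity : HRP2Rigidity → TwoPointLimitIsotropic`.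

References: H. Duminil-Copin, *100 years of the (critical) Ising model on the hypercubic lattice*,
ICM 2022, §8.1; J. Fröhlich, R. Israel, E. H. Lieb, B. Simon, Comm. Math. Phys. 62 (1978), §3.
No definitions are introduced.
-/

namespace Summit.CriticalPhenomena.Ising3DConformalLimit.HyperoctahedralRPTwoPoint

open Literature.Probability.LatticeModels
open Summit.CriticalPhenomena.Ising3DConformalLimit.Theses.HyperoctahedralRP

/-- **The milestone is the crux composed with the glue.** If every continuous positive homogeneous
(`1/2 ≤ Δ ≤ 1`) nine-mirror-invariant, nine-mirror reflection-positive kernel on `ℝ³∖{0}` is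
`O(3)`-invariant (`HRP2Rigidity`, item stmt-1979) and the two-point kernel `x ↦ S 2 (0, x)` of every
non-degenerate translation-invariant scale-covariant pointwise scaling limit `S` of `criticalCorr 3`
satisfies those hypotheses (`TwoPointKernelOfLimit`, item stmt-1983), then every such limit has an
isotropic two-point function (`TwoPointLimitIsotropic`, item stmt-1984). [folklore] -/
theorem twoPointLimitIsotropic_of_rigidity_of_kernel (hA : HRP2Rigidity)
    (hglue : TwoPointKernelOfLimit) : TwoPointLimitIsotropic := by
  intro ρ Δ S hρ hlim hnd htr hsc R x _hx
  obtain ⟨hΔ, hcont, hpos, hhom, hmirror⟩ := hglue ρ Δ S hρ hlim hnd htr hsc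
  exact hA Δ (fun x => S 2 ![0, x]) hΔ.1 hΔ.2 hcont hpos hhom hmirror R x

/-- **`TwoPointLimitIsotropic` hinges on the crux alone**: `HRP2Rigidity → TwoPointLimitIsotropic`,
the glue being the tree theorem `twoPointKernelOfLimit_proof`. Two-point isotropy of the critical
`ℤ³` Ising scaling limit is open in print (Duminil-Copin, ICM 2022, §8.1); this is its reduction to
a statement of pure harmonic analysis. [cite: DuminilCopinICM2022, §8.1] -/
theorem twoPointLimitIsotropic_of_HRP2Rigidity (hA : HRP2Rigidity) : TwoPointLimitIsotropic :=
  twoPointLimitIsotropic_of_rigidity_of_kernel hA twoPointKernelOfLimit_proof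

end Summit.CriticalPhenomena.Ising3DConformalLimit.HyperoctahedralRPTwoPoint
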